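import Summits.CriticalPhenomena.PercolationContinuityZ3.Theorems.PercNearOneGluingNoHeavyQuantFlowPieces
import Summits.CriticalPhenomena.PercolationContinuityZ3.Theorems.PercNearOneGluingNoHeavyQuantLawDecFlowsDecomposition
import Summits.CriticalPhenomena.PercolationContinuityZ3.Theorems.PercNearOneGluingNoHeavyQuantGatedConvSplit
import Summits.CriticalPhenomena.PercolationContinuityZ3.Theorems.PercNearOneGluingNoHeavyQuantLightSliceWideHolds
import Summits.CriticalPhenomena.PercolationContinuityZ3.Theorems.PercNearOneGluingNoHeavyQuantSliceConeForm
import HarnessLib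

/-!
# QUANT lane R8, T-DEC: THE GATE STEP IS FREE BELOW THE FLOOR-QUANTILE — gating a law that is DEC(j) at floor `x` and has
# tail `μ{> j} ≥ x` gives a law that is DEC(j) at the gated floor `q·x` and gated target `q·T`, for EVERY gate `0 < q ≤ 1`

builds on p205010 (kernel theorem, internal audit signed; external expert review pending)

Support file (`--supports stmt-CriticalPhenomena-4575`), QUANT lane LEAD seat prim-quant-lead (gen 41), rung R8 of
`run/shared/lean/prim/quant/LADDER.md`; memo `run/shared/lean/prim/quant/prim-quant-lead-g41/LEAD-NOTES-G41.md` N1–N2.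
Theorems only (no definitions, no `@[conjecture]`), standard axioms, no sorries.  Uses the flow normal form of DEC (typer g22:
`LawDec.FlowAtT`, `decAtT_iff_flowAtT`) and the rate bookkeeping of typer g23/g25 (`usage_giant_eq`, `pairGate_mono_rho`).

THE MECHANISM ("the gate step as spare capacity", lead g41).  Read `gate_q μ = q·μ + (1−q)·δ₀` at floor `q·x`, target `q·T`, layer `j`
as `μ`'s OWN transport problem at a lower floor and a lower target, with the flow scaled by `q`, plus one PHANTOM zero-low of mass
`1 − q`.  Every rate drops: a giant costs `qx/(1−qx) ≤ x/(1−x)` per unit of low mass, a mid `{l, h}` costs the usage of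
`pairGate (qx) (qT) l h ≤ pairGate x T l h` (the credit ratio `(qT − 2l)/(h − l)` drops and `pairGate` is monotone in the floor,
`pairGate_mono_floor`); lows `2l ∈ [qT, T)` disappear; compatibilities `qT < l + h` widen.  So the scaled old flow is feasible, and the
giants ALONE free `q·μ(h)·(1 − q(1−x)/(1−qx))` of column mass each, i.e. room for `μ(h)·(1−q)/x` of phantom zero per giant `h > j`:
the phantom `1 − q` fits as soon as `μ{> j} ≥ x`.

CONSEQUENCE FOR THE TREE INDUCTION (memo N2).  In the conv step of `treeBuilt_sdec` (`SDEC x μ₁ ∧ SDEC x μ₂ ⟹ SDEC x (μ₁ ∗ μ₂)`) the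
ungated product `λ = μ₁ ∗ μ₂` is DEC at every layer at floor `x` (`convClosedT_holds`, census-2 g60) and, being DEC, satisfies the row
`x ≤ λ{> j}` at every dominant layer `2j < T₁ + T₂` (`tail_ge_of_decAt`); by this file `gate_q λ` is then DEC(j) at floor `q·x` for
EVERY gate at every such layer — and at every window layer where the ungated row still holds.  The open content of the gate step
(`GateMove` / `SGCGiantStep` restricted to tree-built factors) is thereby confined to the layers ABOVE the `x`-quantile of the ungated
product (`λ{> j} < x`, hence `2j ≥ T₁ + T₂`) that carry a nonzero low (`λ` charges some `1 ≤ l < qT/2`; otherwise the first-moment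
criterion `flowAtT_of_moment` applies).  This is different information from `SingleGateConvClosed`'s binder, which sees the factors
only through their gated versions at floor `q·x`: the tree induction also knows the UNGATED floor `x`.

* `LawDec.pairGate_mono_floor` — `0 ≤ x′ ≤ x` ⟹ `pairGate x′ T l h ≤ pairGate x T l h`.
* `LawDec.usage_gate_le` — for a low `2l < qT` and an admissible absorber (`j+1 ≤ h` or `T < l + h`, `l < h`):
  `usage (qx) (qT) j l h ≤ usage x T j l h` (`0 < x < 1`, `0 < q ≤ 1`, `0 ≤ T`).
* **`LawDec.flowAtT_gate_of_tail_ge`** — `FlowAtT x T j M μ`, `μ ≥ 0`, `0 < T`, `x ≤ μ{j+1..M}` ⟹ `FlowAtT (qx) (qT) j M (gate μ q)`.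
* **`LawDec.decAtT_gate_of_tail_ge`**, **`LawDec.decAt_gate_of_tail_ge`** — the same in DEC form (explicit target / the mean).
* **`LawDec.gate_lconv_decAt_of_tail_ge`** — THE TREE-INDUCTION COROLLARY: two probability laws, top-affordable and DEC at every layer
  at floor `x` (the `q′ = 1` part of `SDEC x`), and a layer `j < M₁ + M₂` with `x ≤ (μ₁ ∗ μ₂){> j}` ⟹ `gate_q(μ₁ ∗ μ₂)` is `DECAt (q·x) j`
  for EVERY `0 < q ≤ 1` (via `convClosedT_holds`).  **`LawDec.gate_lconv_decAt_dominant_ungated`**: the same at every `2j < T₁ + T₂`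
  (the row of the ungated product comes from `tail_ge_of_decAt`).
EVIDENCE BEFORE THE PROOF (lead g41 explore/lemma1_test.py): 1 326 random general laws DEC(j) with tail `≥ x`, random `q`: 0 failures of
the conclusion; 4 260 arcs: 0 violations of the rate monotonicity.  HONEST STATUS: `GateMove`, `SGCGiantStep` (⟺ `SingleGateConvClosed`),
`SDECConvClosed`, `TreeBuiltDEC`, `FarTreeRow` remain OPEN; this file only removes the layers below the floor-quantile from the gate step;
the RATE class log\* and the honest sentence of `run/shared/lean/prim/quant/README.md` are unchanged.

[this work]; flow normal form and rates: prim-quant-stmt g22/g23/g25, `convClosedT_holds`: prim-quant-census-2 g60 (this lane).  Nothing here is a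
published result.  The gluing rows served [cite: KozmaNitzan2024, Conjecture 3 (p. 15)]; product measure [cite: Grimmett1999, §1.3 p. 10].
-/

noncomputable section

namespace Summit.CriticalPhenomena.PercolationContinuityZ3.Theorems

namespace Quant

open Finset

namespace LawDec

/-! ### Rates drop under a gate -/

/-- **`pairGate` is monotone in the floor**: `0 ≤ x′ ≤ x` ⟹ `pairGate x′ T l h ≤ pairGate x T l h` (for `x′ ≤ ρ` the light branch
`x′² + (1−x′)ρ = ρ − x′(ρ − x′)` is below `ρ`; for `ρ < x′` it is below `x² + (1−x)ρ` since `(x − x′)(x + x′ − ρ) ≥ 0`). [this work] -/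
theorem pairGate_mono_floor (x x' T : ℝ) (l h : ℕ) (hx'0 : 0 ≤ x') (hx'x : x' ≤ x) :
    pairGate x' T l h ≤ pairGate x T l h := by
  unfold pairGate
  set ρ : ℝ := (T - 2 * (l : ℝ)) / ((h : ℝ) - l) with hρ
  refine max_le (le_max_left _ _) ?_
  by_cases hρx : x' ≤ ρ
  · refine le_trans ?_ (le_max_left _ _)
    nlinarith
  · have hρx' : ρ < x' := lt_of_not_ge hρx
    refine le_trans ?_ (le_max_right _ _)
    nlinarith

/-- **usage drops under a gate**: for `0 < x < 1`, `0 < q ≤ 1`, `0 ≤ T`, a low `2l < qT` and an admissible absorber `h` (`j+1 ≤ h`, or a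
mid with `T < l + h`), `usage (qx) (qT) j l h ≤ usage x T j l h`.  Giants: `qx/(1−qx) ≤ x/(1−x)`; mids: the credit ratio drops from
`(T−2l)/(h−l)` to `(qT−2l)/(h−l)` and the floor from `x` to `qx`, and `g ↦ g/(1−g)` is monotone. [this work] -/
theorem usage_gate_le (x T q : ℝ) (j l h : ℕ) (hx0 : 0 < x) (hx1 : x < 1) (hq0 : 0 < q) (hq1 : q ≤ 1) (hT : 0 ≤ T)
    (hlow : 2 * (l : ℝ) < q * T) (hlh : l < h) (hadm : j + 1 ≤ h ∨ T < (l : ℝ) + h) :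
    usage (q * x) (q * T) j l h ≤ usage x T j l h := by
  have hqx1 : q * x < 1 := by nlinarith
  have hqx0 : 0 < q * x := mul_pos hq0 hx0
  have hqTT : q * T ≤ T := by nlinarith
  by_cases hg : j + 1 ≤ h
  · rw [usage_giant_eq (q * x) _ _ _ _ hg, usage_giant_eq x T j l h hg]
    rw [div_le_div_iff₀ (by linarith) (by linarith)]
    nlinarith
  · have hcomp : T < (l : ℝ) + h := by
      rcases hadm with h1 | h2
      · exact absurd h1 hg
      · exact h2
    simp only [usage, gateOf, if_neg hg]
    have hd : (0 : ℝ) < (h : ℝ) - l := by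
      have : (l : ℝ) < h := by exact_mod_cast hlh
      linarith
    have hρ : (q * T - 2 * (l : ℝ)) / ((h : ℝ) - l) ≤ (T - 2 * (l : ℝ)) / ((h : ℝ) - l) := by
      rw [div_le_div_iff_of_pos_right hd]; linarith
    have h1 : pairGate (q * x) (q * T) l h ≤ pairGate (q * x) T l h :=
      pairGate_mono_rho (q * x) _ _ l h l h hqx1.le hρ
    have h2 : pairGate (q * x) T l h ≤ pairGate x T l h := pairGate_mono_floor x (q * x) T l h hqx0.le (by nlinarith)
    have hlowT : 2 * (l : ℝ) < T := lt_of_lt_of_le hlow hqTT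
    have hlt1 : pairGate x T l h < 1 := pairGate_lt_one x T l h hx0 hx1 hlowT hcomp
    have mono : ∀ {a b : ℝ}, a ≤ b → b < 1 → a / (1 - a) ≤ b / (1 - b) := by
      intro a b hab hb
      have ha : 0 < 1 - a := by linarith
      have hb' : 0 < 1 - b := by linarith
      rw [div_le_div_iff₀ ha hb']
      nlinarith
    exact mono (h1.trans h2) hlt1

/-! ### The gate step below the floor-quantile -/

/-- **GATE TRANSPORT OF A FLOW WHEN THE TAIL REACHES THE FLOOR.**  `μ ≥ 0` vanishing above `M`, `0 < T`, a flow witness of DEC(j) for `μ`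
at floor `0 < x < 1` and target `T`, and `x ≤ μ{j+1..M}`.  Then for every gate `0 < q ≤ 1` the gated law `gate μ q` has a flow at floor
`q·x`, target `q·T`, layer `j`: the old flow scaled by `q` on the rows that are still low, plus the phantom zero `1 − q` spread over the
giants `h > j` proportionally to `μ h`.  Column check for a giant: `qx/(1−qx)·(q·μh·(1−x)/x + (1−q)·μh/μ{>j}) ≤ q·μh` iff
`x·(1−q)/μ{>j} ≤ 1 − q`. [this work] -/
theorem flowAtT_gate_of_tail_ge (x T q : ℝ) (j M : ℕ) (μ : ℕ → ℝ) (hx0 : 0 < x) (hx1 : x < 1) (hq0 : 0 < q) (hq1 : q ≤ 1)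
    (hT : 0 < T) (hμ0 : ∀ h, 0 ≤ μ h)
    (htail : x ≤ ∑ h ∈ Finset.Ico (j + 1) (M + 1), μ h) (hF : FlowAtT x T j M μ) :
    FlowAtT (q * x) (q * T) j M (gate μ q) := by
  classical
  obtain ⟨f, hf0, hsupp, hrow, hcap⟩ := hF
  set A : ℝ := ∑ h ∈ Finset.Ico (j + 1) (M + 1), μ h with hA
  have hA0 : 0 < A := lt_of_lt_of_le hx0 htail
  have hqT0 : 0 < q * T := mul_pos hq0 hT
  have hqTT : q * T ≤ T := by nlinarith
  have hqx1 : q * x < 1 := by nlinarith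
  -- the transported flow: scaled old flow on the rows still low, phantom zero spread over the giants
  let f' : ℕ → ℕ → ℝ := fun l h =>
    if 2 * (l : ℝ) < q * T then q * f l h + (if l = 0 ∧ j + 1 ≤ h ∧ h ≤ M then (1 - q) * μ h / A else 0) else 0
  have hextra0 : ∀ l h, 0 ≤ (if l = 0 ∧ j + 1 ≤ h ∧ h ≤ M then (1 - q) * μ h / A else 0) := by
    intro l h
    split_ifs
    · exact div_nonneg (mul_nonneg (by linarith) (hμ0 h)) hA0.le
    · exact le_rfl
  have hf'0 : ∀ l h, 0 ≤ f' l h := by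
    intro l h
    simp only [f']
    by_cases h1 : 2 * (l : ℝ) < q * T
    · rw [if_pos h1]; exact add_nonneg (mul_nonneg hq0.le (hf0 l h)) (hextra0 l h)
    · rw [if_neg h1]
  refine ⟨f', hf'0, fun l h hpos => ?_, fun l hlj hllow => ?_, fun h hhM hhabs => ?_⟩
  · -- support
    simp only [f'] at hpos
    by_cases hl : 2 * (l : ℝ) < q * T
    · rw [if_pos hl] at hpos
      by_cases hfp : 0 < f l h
      · obtain ⟨hlj, _, hhM, hadm⟩ := hsupp l h hfp
        refine ⟨hlj, hl, hhM, ?_⟩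
        rcases hadm with h1 | h2
        · exact Or.inl h1
        · exact Or.inr (lt_of_le_of_lt hqTT h2)
      · have hfz : f l h = 0 := le_antisymm (not_lt.1 hfp) (hf0 l h)
        rw [hfz, mul_zero, zero_add] at hpos
        by_cases hc : l = 0 ∧ j + 1 ≤ h ∧ h ≤ M
        · obtain ⟨hl0, hjh, hhM⟩ := hc
          subst hl0
          exact ⟨Nat.zero_le _, hl, hhM, Or.inl hjh⟩
        · rw [if_neg hc] at hpos; exact absurd hpos (lt_irrefl 0)
    · rw [if_neg hl] at hpos; exact absurd hpos (lt_irrefl 0)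
  · -- rows: a low `l` of the gated problem (`l ≤ j`, `2l < qT`) ships `q·μ l (+ (1−q) if l = 0) = gate μ q l`
    have hllowT : 2 * (l : ℝ) < T := lt_of_lt_of_le hllow hqTT
    have e : ∀ h, f' l h = q * f l h + (if l = 0 ∧ j + 1 ≤ h ∧ h ≤ M then (1 - q) * μ h / A else 0) := by
      intro h; simp only [f', if_pos hllow]
    simp_rw [e]
    rw [Finset.sum_add_distrib, ← Finset.mul_sum, hrow l hlj hllowT]
    simp only [gate]
    by_cases hl0 : l = 0
    · subst hl0
      simp only [true_and, if_true]
      have e2 : ∀ h, (if j + 1 ≤ h ∧ h ≤ M then (1 - q) * μ h / A else 0) =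
          (if j + 1 ≤ h then (if h ≤ M then (1 - q) / A * μ h else 0) else 0) := by
        intro h
        by_cases h1 : j + 1 ≤ h
        · by_cases h2 : h ≤ M
          · rw [if_pos ⟨h1, h2⟩, if_pos h1, if_pos h2]; ring
          · rw [if_neg (fun hc => h2 hc.2), if_pos h1, if_neg h2]
        · rw [if_neg (fun hc => h1 hc.1), if_neg h1]
      simp_rw [e2]
      rw [sum_range_ite_ge_eq_Ico]
      have e3 : ∑ h ∈ Finset.Ico (j + 1) (M + 1), (if h ≤ M then (1 - q) / A * μ h else 0) =
          ∑ h ∈ Finset.Ico (j + 1) (M + 1), (1 - q) / A * μ h := by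
        refine Finset.sum_congr rfl fun h hh => ?_
        rw [Finset.mem_Ico] at hh
        rw [if_pos (by omega)]
      rw [e3, ← Finset.mul_sum, ← hA, div_mul_cancel₀ _ hA0.ne']
    · have e2 : ∀ h, (if l = 0 ∧ j + 1 ≤ h ∧ h ≤ M then (1 - q) * μ h / A else 0) = 0 := by
        intro h; rw [if_neg (fun hc => hl0 hc.1)]
      simp_rw [e2]
      rw [Finset.sum_const_zero, add_zero, if_neg hl0, add_zero]
  · -- columns
    have hh0 : h ≠ 0 := by
      rintro rfl
      rcases hhabs with h1 | h2
      · omega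
      · simp at h2; linarith
    have hgate : gate μ q h = q * μ h := by
      simp only [gate, if_neg hh0, add_zero]
    rw [hgate]
    by_cases hg : j + 1 ≤ h
    · -- a giant: old load `x/(1−x)·Σ f ≤ μ h`, new rate `qx/(1−qx)`, plus the phantom share
      have hug : ∀ l, usage (q * x) (q * T) j l h = q * x / (1 - q * x) := fun l => usage_giant_eq (q * x) _ _ l h hg
      have hold : x / (1 - x) * ∑ l ∈ Finset.range (j + 1), f l h ≤ μ h := by
        have := hcap h hhM (Or.inl hg)
        rw [Finset.mul_sum]
        calc ∑ l ∈ Finset.range (j + 1), x / (1 - x) * f l h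
            = ∑ l ∈ Finset.range (j + 1), usage x T j l h * f l h :=
              Finset.sum_congr rfl fun l _ => by rw [usage_giant_eq x T j l h hg]
          _ ≤ μ h := this
      -- bound the transported flow termwise
      have hterm : ∀ l, l ∈ Finset.range (j + 1) →
          usage (q * x) (q * T) j l h * f' l h ≤
            q * x / (1 - q * x) * (q * f l h + (if l = 0 then (1 - q) * μ h / A else 0)) := by
        intro l _
        rw [hug l]
        refine mul_le_mul_of_nonneg_left ?_ (div_nonneg (mul_nonneg hq0.le hx0.le) (by linarith))
        simp only [f']
        by_cases hl : 2 * (l : ℝ) < q * T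
        · rw [if_pos hl]
          refine add_le_add le_rfl ?_
          by_cases hl0 : l = 0
          · subst hl0
            rw [if_pos ⟨rfl, hg, hhM⟩, if_pos rfl]
          · rw [if_neg (fun hc => hl0 hc.1), if_neg hl0]
        · rw [if_neg hl]
          refine add_nonneg (mul_nonneg hq0.le (hf0 l h)) ?_
          split_ifs
          · exact div_nonneg (mul_nonneg (by linarith) (hμ0 h)) hA0.le
          · exact le_rfl
      have hsum0 : ∑ l ∈ Finset.range (j + 1), (if l = 0 then (1 - q) * μ h / A else 0) = (1 - q) * μ h / A := by
        rw [Finset.sum_ite_eq' (Finset.range (j + 1)) 0, if_pos (Finset.mem_range.2 (Nat.succ_pos j))]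
      calc ∑ l ∈ Finset.range (j + 1), usage (q * x) (q * T) j l h * f' l h
          ≤ ∑ l ∈ Finset.range (j + 1), q * x / (1 - q * x) * (q * f l h + (if l = 0 then (1 - q) * μ h / A else 0)) :=
            Finset.sum_le_sum hterm
        _ = q * x / (1 - q * x) * (q * ∑ l ∈ Finset.range (j + 1), f l h + (1 - q) * μ h / A) := by
            rw [← Finset.mul_sum, Finset.sum_add_distrib, ← Finset.mul_sum, hsum0]
        _ ≤ q * μ h := by
            have hS : ∑ l ∈ Finset.range (j + 1), f l h ≤ μ h * (1 - x) / x := by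
              rw [le_div_iff₀ hx0]
              have := hold
              rw [div_mul_eq_mul_div, div_le_iff₀ (by linarith)] at this
              linarith
            have hxA : x / A ≤ 1 := (div_le_one hA0).2 htail
            have hμh := hμ0 h
            have hq1' : 0 ≤ 1 - q := by linarith
            have hqx' : 0 < 1 - q * x := by linarith
            rw [div_mul_eq_mul_div, div_le_iff₀ hqx']
            have h3 : (1 - q) * μ h / A = (1 - q) * μ h * (1 / A) := by ring
            have hA1 : x * (1 / A) ≤ 1 := by rwa [mul_one_div]
            have h4 : q * x * ((1 - q) * μ h / A) ≤ q * ((1 - q) * μ h) := by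
              rw [h3]
              have : q * x * ((1 - q) * μ h * (1 / A)) = q * ((1 - q) * μ h) * (x * (1 / A)) := by ring
              rw [this]
              exact mul_le_of_le_one_right (mul_nonneg hq0.le (mul_nonneg hq1' hμh)) hA1
            have h5 : q * x * (q * ∑ l ∈ Finset.range (j + 1), f l h) ≤ q * x * (q * (μ h * (1 - x) / x)) :=
              mul_le_mul_of_nonneg_left (mul_le_mul_of_nonneg_left hS hq0.le) (mul_nonneg hq0.le hx0.le)
            have h6 : q * x * (q * (μ h * (1 - x) / x)) = q * q * μ h * (1 - x) := by
              field_simp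
            rw [mul_add]
            nlinarith [h4, h5, h6, mul_nonneg hq0.le hμh]
    · -- a mid `h ≤ j` with `qT ≤ 2h`: no phantom term; either an old absorber (rates drop termwise) or unused by the old flow
      have hhj : h ≤ j := by omega
      have hmid : q * T ≤ 2 * (h : ℝ) := by
        rcases hhabs with h1 | h2
        · exact absurd h1 hg
        · exact h2
      have e : ∀ l, f' l h = if 2 * (l : ℝ) < q * T then q * f l h else 0 := by
        intro l
        simp only [f']
        split_ifs with h1 h2
        · exact absurd h2.2.1 hg
        · rw [add_zero]
        · rfl
      simp_rw [e]
      by_cases hold : T ≤ 2 * (h : ℝ)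
      · have hcapold := hcap h hhM (Or.inr hold)
        calc ∑ l ∈ Finset.range (j + 1), usage (q * x) (q * T) j l h * (if 2 * (l : ℝ) < q * T then q * f l h else 0)
            ≤ ∑ l ∈ Finset.range (j + 1), q * (usage x T j l h * f l h) := by
              refine Finset.sum_le_sum fun l _ => ?_
              rcases (hf0 l h).eq_or_lt with hz | hpos
              · rw [← hz]; simp
              · obtain ⟨_, hl2, _, hadm⟩ := hsupp l h hpos
                have hlh : l < h := by
                  have hlt : (l : ℝ) < h := by
                    rcases hadm with h1 | h2
                    · exact_mod_cast (show l < h by omega)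
                    · linarith
                  exact_mod_cast hlt
                have hupos : 0 < usage x T j l h := usage_pos_of_compat x T j l h hx0 hx1 hl2 hlh hadm
                split_ifs with hl
                · have hu := usage_gate_le x T q j l h hx0 hx1 hq0 hq1 hT.le hl hlh hadm
                  have := mul_le_mul_of_nonneg_right hu (mul_nonneg hq0.le hpos.le)
                  nlinarith [this]
                · rw [mul_zero]; exact mul_nonneg hq0.le (mul_nonneg hupos.le hpos.le)
          _ = q * ∑ l ∈ Finset.range (j + 1), usage x T j l h * f l h := by rw [Finset.mul_sum]
          _ ≤ q * μ h := mul_le_mul_of_nonneg_left hcapold hq0.le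
      · -- `2h < T`: the old flow never charges `h` (a used pair has `T < l + h` and `2l < T`, so `2h > T`)
        have hz : ∀ l, l ∈ Finset.range (j + 1) → usage (q * x) (q * T) j l h * (if 2 * (l : ℝ) < q * T then q * f l h else 0) = 0 := by
          intro l _
          split_ifs with hl
          · rcases (hf0 l h).eq_or_lt with hz | hpos
            · rw [← hz]; simp
            · obtain ⟨_, hl2, _, hadm⟩ := hsupp l h hpos
              exfalso
              rcases hadm with h1 | h2
              · exact hg h1
              · have hold' : 2 * (h : ℝ) < T := lt_of_not_ge hold
                linarith
          · rw [mul_zero]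
        rw [Finset.sum_eq_zero hz]
        exact mul_nonneg hq0.le (hμ0 h)

/-! ### DEC forms and the tree-induction corollary -/

/-- **DEC form (explicit target)**: a probability law `μ` on `{0..M}` that is `DECAtT x T j` with `0 < T` and `x ≤ μ{j+1..M}` has
`gate μ q` `DECAtT (q·x) (q·T) j` for every gate `0 < q ≤ 1`. [this work] -/
theorem decAtT_gate_of_tail_ge (x T q : ℝ) (j M : ℕ) (μ : ℕ → ℝ) (hx0 : 0 < x) (hx1 : x < 1) (hq0 : 0 < q) (hq1 : q ≤ 1)
    (hT : 0 < T) (hμ0 : ∀ h, 0 ≤ μ h) (hμM : ∀ h, M < h → μ h = 0) (hμ1 : ∑ h ∈ Finset.range (M + 1), μ h = 1)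
    (htail : x ≤ ∑ h ∈ Finset.Ico (j + 1) (M + 1), μ h) (hD : DECAtT x T j M μ) :
    DECAtT (q * x) (q * T) j M (gate μ q) := by
  have hqx0 : 0 < q * x := mul_pos hq0 hx0
  have hqx1 : q * x < 1 := by nlinarith
  obtain ⟨_, gM, g1⟩ := gate_laws M μ q hq0.le hq1 hμ0 hμM hμ1
  exact decAtT_of_flowAtT (q * x) (q * T) j M (gate μ q) hqx0 hqx1 gM g1
    (flowAtT_gate_of_tail_ge x T q j M μ hx0 hx1 hq0 hq1 hT hμ0 htail (flowAtT_of_decAtT x T j M μ hx0 hx1 hD))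

/-- the mean dominates the tail: `Σ h·μ h ≥ μ{j+1..M}` for `μ ≥ 0`. [this work] -/
theorem tail_le_mean (j M : ℕ) (μ : ℕ → ℝ) (hμ0 : ∀ h, 0 ≤ μ h) :
    ∑ h ∈ Finset.Ico (j + 1) (M + 1), μ h ≤ ∑ h ∈ Finset.range (M + 1), (h : ℝ) * μ h := by
  rw [← sum_range_ite_ge_eq_Ico]
  refine Finset.sum_le_sum fun h _ => ?_
  split_ifs with hj
  · have h1 : (1 : ℝ) ≤ h := by exact_mod_cast (show 1 ≤ h by omega)
    nlinarith [hμ0 h]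
  · exact mul_nonneg (Nat.cast_nonneg h) (hμ0 h)

/-- **DEC form (at the mean)**: `DECAt x j M μ` (probability law, `x ≤ μ{j+1..M}`) ⟹ `DECAt (q·x) j M (gate μ q)` for every
`0 < q ≤ 1` (the mean of the gated law is `q ×` the mean). [this work] -/
theorem decAt_gate_of_tail_ge (x q : ℝ) (j M : ℕ) (μ : ℕ → ℝ) (hx0 : 0 < x) (hx1 : x < 1) (hq0 : 0 < q) (hq1 : q ≤ 1)
    (hμ0 : ∀ h, 0 ≤ μ h) (hμM : ∀ h, M < h → μ h = 0) (hμ1 : ∑ h ∈ Finset.range (M + 1), μ h = 1)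
    (htail : x ≤ ∑ h ∈ Finset.Ico (j + 1) (M + 1), μ h) (hD : DECAt x j M μ) :
    DECAt (q * x) j M (gate μ q) := by
  rw [decAt_iff_decAtT] at hD ⊢
  rw [sum_mul_gate]
  have hT : 0 < ∑ h ∈ Finset.range (M + 1), (h : ℝ) * μ h :=
    lt_of_lt_of_le (lt_of_lt_of_le hx0 htail) (tail_le_mean j M μ hμ0)
  exact decAtT_gate_of_tail_ge x _ q j M μ hx0 hx1 hq0 hq1 hT hμ0 hμM hμ1 htail hD

/-- **THE GATE STEP OF THE TREE INDUCTION IS FREE BELOW THE FLOOR-QUANTILE OF THE UNGATED PRODUCT.**  Two probability laws on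
`{0..M₁}`, `{0..M₂}`, top-affordable at floor `0 < x < 1` on their charged atoms and DEC at every layer below their tops (the
`q′ = 1` part of `SDEC x`), and a layer `j < M₁ + M₂` at which the UNGATED product still satisfies the row `x ≤ (μ₁ ∗ μ₂){> j}`:
then `gate_q (μ₁ ∗ μ₂)` is `DECAt (q·x) j (M₁ + M₂)` for every gate `0 < q ≤ 1`.  (`convClosedT_holds` makes the product DEC(j) at
floor `x`; then `decAt_gate_of_tail_ge`.) [this work] -/
theorem gate_lconv_decAt_of_tail_ge (x q : ℝ) (M₁ M₂ : ℕ) (μ₁ μ₂ : ℕ → ℝ) (hx0 : 0 < x) (hx1 : x < 1) (hq0 : 0 < q) (hq1 : q ≤ 1)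
    (h10 : ∀ h, 0 ≤ μ₁ h) (h1M : ∀ h, M₁ < h → μ₁ h = 0) (h11 : ∑ h ∈ Finset.range (M₁ + 1), μ₁ h = 1)
    (h20 : ∀ h, 0 ≤ μ₂ h) (h2M : ∀ h, M₂ < h → μ₂ h = 0) (h21 : ∑ h ∈ Finset.range (M₂ + 1), μ₂ h = 1)
    (hta1 : ∀ h, 0 < μ₁ h → x * (h : ℝ) ≤ ∑ k ∈ Finset.range (M₁ + 1), (k : ℝ) * μ₁ k)
    (hta2 : ∀ h, 0 < μ₂ h → x * (h : ℝ) ≤ ∑ k ∈ Finset.range (M₂ + 1), (k : ℝ) * μ₂ k)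
    (hdec1 : ∀ j'', j'' < M₁ → DECAt x j'' M₁ μ₁) (hdec2 : ∀ j'', j'' < M₂ → DECAt x j'' M₂ μ₂)
    (j : ℕ) (hj : j < M₁ + M₂) (htail : x ≤ ∑ h ∈ Finset.Ico (j + 1) (M₁ + M₂ + 1), lconv M₁ M₂ μ₁ μ₂ h) :
    DECAt (q * x) j (M₁ + M₂) (gate (lconv M₁ M₂ μ₁ μ₂) q) :=
  decAt_gate_of_tail_ge x q j (M₁ + M₂) (lconv M₁ M₂ μ₁ μ₂) hx0 hx1 hq0 hq1 (lconv_nonneg M₁ M₂ μ₁ μ₂ h10 h20)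
    (fun h hh => lconv_eq_zero M₁ M₂ μ₁ μ₂ h hh) (sum_lconv M₁ M₂ μ₁ μ₂ h11 h21) htail
    (decAt_lconv_of_convClosedT convClosedT_holds x M₁ M₂ μ₁ μ₂ hx0 hx1 h10 h1M h11 h20 h2M h21 hta1 hta2 hdec1 hdec2 j hj)

/-- **in particular at every DOMINANT layer of the ungated product** (`2j < T₁ + T₂`, `j < M₁ + M₂`): there the ungated product, being
DEC(j) at floor `x`, satisfies the row by `tail_ge_of_decAt`, so `gate_q(μ₁ ∗ μ₂)` is `DECAt (q·x) j` for every gate — the layers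
`2j ∈ [q(T₁+T₂), T₁+T₂)`, non-dominant for the gated product, included. [this work] -/
theorem gate_lconv_decAt_dominant_ungated (x q : ℝ) (M₁ M₂ : ℕ) (μ₁ μ₂ : ℕ → ℝ) (hx0 : 0 < x) (hx1 : x < 1)
    (hq0 : 0 < q) (hq1 : q ≤ 1)
    (h10 : ∀ h, 0 ≤ μ₁ h) (h1M : ∀ h, M₁ < h → μ₁ h = 0) (h11 : ∑ h ∈ Finset.range (M₁ + 1), μ₁ h = 1)
    (h20 : ∀ h, 0 ≤ μ₂ h) (h2M : ∀ h, M₂ < h → μ₂ h = 0) (h21 : ∑ h ∈ Finset.range (M₂ + 1), μ₂ h = 1)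
    (hta1 : ∀ h, 0 < μ₁ h → x * (h : ℝ) ≤ ∑ k ∈ Finset.range (M₁ + 1), (k : ℝ) * μ₁ k)
    (hta2 : ∀ h, 0 < μ₂ h → x * (h : ℝ) ≤ ∑ k ∈ Finset.range (M₂ + 1), (k : ℝ) * μ₂ k)
    (hdec1 : ∀ j'', j'' < M₁ → DECAt x j'' M₁ μ₁) (hdec2 : ∀ j'', j'' < M₂ → DECAt x j'' M₂ μ₂)
    (j : ℕ) (hj : j < M₁ + M₂)
    (hdom : (2 * j : ℝ) < ∑ h ∈ Finset.range (M₁ + 1), (h : ℝ) * μ₁ h + ∑ h ∈ Finset.range (M₂ + 1), (h : ℝ) * μ₂ h) :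
    DECAt (q * x) j (M₁ + M₂) (gate (lconv M₁ M₂ μ₁ μ₂) q) := by
  have hD := decAt_lconv_of_convClosedT convClosedT_holds x M₁ M₂ μ₁ μ₂ hx0 hx1 h10 h1M h11 h20 h2M h21 hta1 hta2 hdec1 hdec2 j hj
  refine gate_lconv_decAt_of_tail_ge x q M₁ M₂ μ₁ μ₂ hx0 hx1 hq0 hq1 h10 h1M h11 h20 h2M h21 hta1 hta2 hdec1 hdec2 j hj ?_
  have hdom' : (2 * j : ℝ) < ∑ h ∈ Finset.range (M₁ + M₂ + 1), (h : ℝ) * lconv M₁ M₂ μ₁ μ₂ h := by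
    rw [sum_mul_lconv M₁ M₂ μ₁ μ₂ h11 h21]; exact hdom
  exact tail_ge_of_decAt x j (M₁ + M₂) (lconv M₁ M₂ μ₁ μ₂) hx1.le hD hdom'

end LawDec

end Quant

end Summit.CriticalPhenomena.PercolationContinuityZ3.Theorems
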